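import Summits.NavierStokesRegularity.FluidComputer.CrayaCoordinates
import Summits.NavierStokesRegularity.FluidComputer.AbcLinearisedLattice

/-!
# The certifier's scalar matrix of the ABC linearisation in Craya coordinates: band, row action as
# the cross form, first-order growth, and the end-to-end synthesis from a coordinate eigenvector
(instab3 g5 — implementation 1 of the skew-cut X0 certifier, cell `ns-blowup`, 2026-08-26)

HONEST FRAMING (human ruling D-0035): nothing here is a claim about Navier–Stokes blow-up.
WHAT THIS IS NOT: not NS evidence. MODEL lane: exact bookkeeping of ONE linear operator — the
linearisation of the Navier–Stokes system about `U = Torus.abcFlow A B C` — in the coordinates of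
implementation 1 (`HOME/instab3/code/i3core.py`: `A[(k,a),(k',b)] = e_a(k)·(Û_q × (i k'×e_b(k') − e_b(k')))`,
`q = k − k' ∈ {±e_j}`; INSTAB3-METHOD §1/§2/§4). Sequel of `CrayaFrames` / `CrayaCoordinates`;
KERNEL-CHAIN.md (HOME/instab4) residues (i)/(iii) and the operator-specific half of (A2):

* §4 `abcCrayaMatrix A B C i j` (the entry above; `0` off the shell `k_i − k_j ∈ {±e_m}`) and the band
  `crayaNbr i` (the ≤ 12 indices `(k_i − q_y, b)`; symmetric; lattice neighbours `|k_i − k_j|² = 1`);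
  **row action** `sum_abcCrayaMatrix_mul_eq_inner`:
  `∑_{j ∈ band(i)} A_{ij} v_j = ⟪e_a(k), ∑_y â(q_y) × (i (k−q_y) × c(k−q_y) − c(k−q_y))⟫`, `c = crayaSynth v`
  — the matrix acts on coordinates as the cross-form operator of
  `AbcLinearisedLattice.isLinNSEigenvalue_abcFlow_of_crossForm` acts on the synthesised vector family.
* §5 **end-to-end in coordinates** (`isLinNSEigenvalue_abcFlow_of_craya_eigen`): a non-zero coordinate
  family with all polynomial weights square-summable solving `−ν|k_i|² v_i + ∑_j A_{ij} v_j = μ v_i`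
  gives `Torus.IsLinNSEigenvalue (ν/(2π)) (abcFlow A B C) (2πμ)` (Leray multiplier in frame
  coordinates + row action + `rapidDecay_crayaSynth` + the synthesis door).
* §6 **growth** (`norm_abcCrayaMatrix_le`): `‖A_{ij}‖ ≤ 9 (|A| + |B| + |C|) ⟨k_j⟩` from the factored
  (transport + stretch) form of the entries (`abcCrayaMatrix_eq_of_sub_eq`, via
  `AbcLinearisedLattice.cross_form_pointwise` and `⟪e_a(k), k⟫ = 0`).

Units as in `AbcLinearisedLattice` (period `2π` ↔ unit torus: `λ ↦ 2πλ`, `ν ↦ ν/(2π)`). Mathlib + tree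
files only. New definitions (review lane): `abcCrayaMatrix`, `crayaNbr`.
-/

noncomputable section

open scoped BigOperators InnerProductSpace ComplexConjugate Matrix
open Finset Matrix

namespace Summit.NavierStokesRegularity.FluidComputer.AbcCrayaMatrix

open Literature.Analysis.FluidPDE Literature.Analysis.FluidPDE.SteadyLattice
open Literature.Analysis.FunctionSpaces Literature.Analysis.FunctionSpaces.Torus
open Summit.NavierStokesRegularity.FluidComputer.CrayaFrames

/-! ### §4 The certifier's scalar matrix of the ABC linearisation in Craya coordinates -/

/-- **The certifier's advective matrix in Craya coordinates** (INSTAB3-METHOD §1/§2; i3core.py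
`A[(k,a),(k',b)] = e_a(k)·(Û_q × (i k'×e_b(k') − e_b(k')))`, `q = k − k' ∈ {±e_j}`): for Craya indices
`i = (k, a)`, `j = (k', b)`, the entry is `⟪e_a(k), â(k − k') × (i k' × e_b(k') − e_b(k'))⟫` when
`k − k'` lies on the ABC shell, and `0` otherwise (`â = Torus.abcCoeff A B C`, the Fourier
coefficients of `Torus.abcFlow A B C`; period-`2π` units, i.e. `−(2π)⁻¹×` the unit-torus
linearisation, `AbcLinearisedLattice.lerayCoeff_linSym_abcFlow_eq_cross`). Marked `irreducible`
(unfold with `rw [abcCrayaMatrix]`): definitional unfolding of the entries during unification is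
expensive. -/
@[irreducible] def abcCrayaMatrix (A B C : ℝ) (i j : CrayaIdx) : ℂ :=
  if i.1.1 - j.1.1 ∈ Torus.abcFreq then
    ⟪crayaVec i.2 i.1.1, WithLp.toLp 2 (WithLp.ofLp (Torus.abcCoeff A B C (i.1.1 - j.1.1)) ⨯₃
      (Complex.I • ((fun m : Fin 3 => ((j.1.1 m : ℤ) : ℂ)) ⨯₃ WithLp.ofLp (crayaVec j.2 j.1.1)) -
        WithLp.ofLp (crayaVec j.2 j.1.1)))⟫_ℂ
  else 0

/-- **The band**: the Craya indices coupled to `i = (k, a)` are the `(k − q_y, b)` with `k − q_y ≠ 0`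
(`q_y = Torus.abcDir y` the six shell frequencies, `b ∈ Fin 2`): at most twelve. Marked `irreducible`
(use `mem_crayaNbr`; unfold with `rw [crayaNbr]`): unfolding the `Finset` construction during
unification is very expensive. -/
@[irreducible] def crayaNbr (i : CrayaIdx) : Finset CrayaIdx :=
  ((Finset.univ.image fun y : Fin 3 × Bool => i.1.1 - Torus.abcDir y).subtype fun k => k ≠ 0) ×ˢ
    Finset.univ

/-- Membership in the band: `j ∈ crayaNbr i ↔ k_i − k_j ∈ {±e_m}`. -/
theorem mem_crayaNbr {i j : CrayaIdx} : j ∈ crayaNbr i ↔ i.1.1 - j.1.1 ∈ Torus.abcFreq := by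
  rw [crayaNbr, Finset.mem_product, Finset.mem_subtype, Finset.mem_image, Torus.mem_abcFreq]
  simp only [Finset.mem_univ, true_and, and_true]
  constructor
  · rintro ⟨y, hy⟩; exact ⟨y, by rw [← hy]; abel⟩
  · rintro ⟨y, hy⟩; exact ⟨y, by rw [hy]; abel⟩

/-- The band is symmetric. -/
theorem mem_crayaNbr_comm (i j : CrayaIdx) : j ∈ crayaNbr i ↔ i ∈ crayaNbr j := by
  rw [mem_crayaNbr, mem_crayaNbr]
  constructor <;> intro h <;> simpa using Torus.neg_mem_abcFreq _ h

/-- The band has at most `12` elements (`6` shell frequencies × `2` frame labels). -/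
theorem card_crayaNbr_le (i : CrayaIdx) : (crayaNbr i).card ≤ 12 := by
  rw [crayaNbr, Finset.card_product, Finset.card_univ, Fintype.card_fin]
  have h1 : ((Finset.univ.image fun y : Fin 3 × Bool => i.1.1 - Torus.abcDir y).subtype
      fun k => k ≠ 0).card ≤ (Finset.univ.image fun y : Fin 3 × Bool => i.1.1 - Torus.abcDir y).card := by
    rw [Finset.card_subtype]
    exact Finset.card_filter_le _ _
  have h2 : (Finset.univ.image fun y : Fin 3 × Bool => i.1.1 - Torus.abcDir y).card ≤ 6 :=
    Finset.card_image_le.trans (by simp)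
  linarith [h1.trans h2]

/-- Band neighbours are lattice neighbours: `|k_i − k_j|² = 1`. -/
theorem freqNormSq_sub_of_mem_crayaNbr {i j : CrayaIdx} (h : j ∈ crayaNbr i) :
    freqNormSq (i.1.1 - j.1.1) = 1 := by
  obtain ⟨y, hy⟩ := Torus.mem_abcFreq.mp (mem_crayaNbr.mp h)
  rw [← hy, Torus.freqNormSq_abcDir]

/-- **Locality**: the matrix vanishes off the band. -/
theorem abcCrayaMatrix_eq_zero_of_not_mem (A B C : ℝ) {i j : CrayaIdx} (h : j ∉ crayaNbr i) :
    abcCrayaMatrix A B C i j = 0 := by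
  rw [mem_crayaNbr] at h
  rw [abcCrayaMatrix, if_neg h]

/-- Sums over the band, written as sums over the six shell frequencies and the two frame labels
(terms at a vanishing neighbour frequency `k − q_y = 0` are absent). -/
theorem sum_crayaNbr_eq {M : Type*} [AddCommMonoid M] (i : CrayaIdx) (f : CrayaIdx → M) :
    ∑ j ∈ crayaNbr i, f j = ∑ y : Fin 3 × Bool, ∑ b : Fin 2,
      if h : i.1.1 - Torus.abcDir y = 0 then 0 else f (⟨i.1.1 - Torus.abcDir y, h⟩, b) := by
  classical
  set g : (Fin 3 → ℤ) → M := fun x => ∑ b : Fin 2, if h : x = 0 then 0 else f (⟨x, h⟩, b) with hg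
  have hinj : Function.Injective fun y : Fin 3 × Bool => i.1.1 - Torus.abcDir y :=
    fun y y' hyy' => Torus.abcDir_injective (sub_right_injective hyy')
  rw [crayaNbr, Finset.sum_product]
  have h1 : ∑ x ∈ (Finset.univ.image fun y : Fin 3 × Bool => i.1.1 - Torus.abcDir y).subtype
      (fun k => k ≠ 0), ∑ b : Fin 2, f (x, b) =
      ∑ x ∈ (Finset.univ.image fun y : Fin 3 × Bool => i.1.1 - Torus.abcDir y).subtype (fun k => k ≠ 0),
        g x.1 := by
    refine Finset.sum_congr rfl fun x _ => Finset.sum_congr rfl fun b _ => ?_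
    rw [dif_neg x.2]
  rw [h1, Finset.sum_subtype_eq_sum_filter, Finset.sum_filter_of_ne, Finset.sum_image fun y _ y' _ h =>
    hinj h]
  intro x _ hx h0
  apply hx
  rw [hg]
  simp [h0]

/-- Linearity of the cross form in the frame coefficients: for a frame expansion
`c = ∑_b v_b e_b(k')`, `â × (i k' × c − c) = ∑_b v_b (â × (i k' × e_b(k') − e_b(k')))`. -/
theorem cross_form_sum_smul (a : Fin 3 → ℂ) (kc : Fin 3 → ℂ) (v : Fin 2 → ℂ) (k' : Fin 3 → ℤ) :
    a ⨯₃ (Complex.I • (kc ⨯₃ WithLp.ofLp (∑ b, v b • crayaVec b k')) -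
        WithLp.ofLp (∑ b, v b • crayaVec b k')) =
      ∑ b, v b • (a ⨯₃ (Complex.I • (kc ⨯₃ WithLp.ofLp (crayaVec b k')) - WithLp.ofLp (crayaVec b k'))) := by
  simp only [WithLp.ofLp_sum, WithLp.ofLp_smul, map_sum, map_smul, map_sub, Finset.smul_sum, smul_sub,
    Finset.sum_sub_distrib]
  congr 1
  refine Finset.sum_congr rfl fun b _ => ?_
  rw [smul_comm]

/-- **Row action = frame component of the cross form.** For every scalar family `v` on the Craya
index set and every index `i = (k, a)`:
`∑_{j ∈ band(i)} A_{ij} v_j = ⟪e_a(k), ∑_y â(q_y) × (i (k − q_y) × c(k − q_y) − c(k − q_y))⟫`,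
`c = crayaSynth v` — the certifier's matrix acts on coordinates as the cross-form operator acts on
the synthesised vector family. -/
theorem sum_abcCrayaMatrix_mul_eq_inner (A B C : ℝ) (v : CrayaIdx → ℂ) (i : CrayaIdx) :
    ∑ j ∈ crayaNbr i, abcCrayaMatrix A B C i j * v j =
      ⟪crayaVec i.2 i.1.1, ∑ y : Fin 3 × Bool,
        WithLp.toLp 2 (WithLp.ofLp (Torus.abcCoeff A B C (Torus.abcDir y)) ⨯₃
          (Complex.I • ((fun m : Fin 3 => (((i.1.1 - Torus.abcDir y) m : ℤ) : ℂ)) ⨯₃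
            WithLp.ofLp (crayaSynth v (i.1.1 - Torus.abcDir y))) -
            WithLp.ofLp (crayaSynth v (i.1.1 - Torus.abcDir y))))⟫_ℂ := by
  rw [sum_crayaNbr_eq, inner_sum]
  refine Finset.sum_congr rfl fun y _ => ?_
  by_cases h0 : i.1.1 - Torus.abcDir y = 0
  · -- vanishing neighbour frequency: both sides are zero
    simp only [h0, dif_pos]
    rw [Finset.sum_const_zero, crayaSynth_zero_freq]
    have : (fun m : Fin 3 => (((0 : Fin 3 → ℤ) m : ℤ) : ℂ)) = 0 := by funext m; simp
    rw [this]
    simp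
  · simp only [h0, dif_neg, not_false_eq_true]
    have hq : i.1.1 - (i.1.1 - Torus.abcDir y) = Torus.abcDir y := sub_sub_cancel _ _
    have hmem : Torus.abcDir y ∈ Torus.abcFreq := Torus.mem_abcFreq.mpr ⟨y, rfl⟩
    simp only [abcCrayaMatrix, hq, if_pos hmem]
    rw [crayaSynth_of_ne_zero v h0, cross_form_sum_smul, WithLp.toLp_sum, inner_sum]
    refine Finset.sum_congr rfl fun b _ => ?_
    rw [WithLp.toLp_smul, inner_smul_right, mul_comm]

/-- The row action over ANY index set carrying the band: if `A_{ij} = 0` for `j ∉ nbr i`, then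
`∑_{j ∈ nbr i} A_{ij} v_j = ∑_{j ∈ band(i)} A_{ij} v_j`. -/
theorem sum_abcCrayaMatrix_mul_eq_of_band (A B C : ℝ) (v : CrayaIdx → ℂ) (nbr : CrayaIdx → Finset CrayaIdx)
    (hnbr : ∀ i j, j ∉ nbr i → abcCrayaMatrix A B C i j = 0) (i : CrayaIdx) :
    ∑ j ∈ nbr i, abcCrayaMatrix A B C i j * v j = ∑ j ∈ crayaNbr i, abcCrayaMatrix A B C i j * v j := by
  classical
  have h1 : ∑ j ∈ nbr i, abcCrayaMatrix A B C i j * v j =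
      ∑ j ∈ nbr i ∪ crayaNbr i, abcCrayaMatrix A B C i j * v j :=
    Finset.sum_subset Finset.subset_union_left fun j _ hj => by rw [hnbr i j hj, zero_mul]
  have h2 : ∑ j ∈ crayaNbr i, abcCrayaMatrix A B C i j * v j =
      ∑ j ∈ nbr i ∪ crayaNbr i, abcCrayaMatrix A B C i j * v j :=
    Finset.sum_subset Finset.subset_union_right fun j _ hj => by
      rw [abcCrayaMatrix_eq_zero_of_not_mem A B C hj, zero_mul]
  rw [h1, h2]

/-! ### §5 End-to-end in coordinates: a Craya-coordinate eigenvector is a classical eigenpair -/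

/-- **Craya-coordinate eigenvector ⇒ classical eigenpair of the linearisation about the ABC flow.**
Let `v` be a non-zero scalar family on the Craya index set with all polynomial weights square-summable
(`∑ (1 + ν|k|²)^s |v|² < ∞ ∀ s`, `ν > 0`) solving the certifier's eigen-equation in coordinates,
`−ν|k_i|² v_i + ∑_{j ∈ nbr i} A_{ij} v_j = μ v_i` for all `i`, where `A = abcCrayaMatrix A B C` and
`nbr` is any band (`A_{ij} = 0` off `nbr i`). Then `2πμ` is an eigenvalue of the linearised
Navier–Stokes operator about `Torus.abcFlow A B C` on the unit torus with viscosity `ν/(2π)`: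
`Torus.IsLinNSEigenvalue (ν/(2π)) (abcFlow A B C) (2πμ)` — the output format of
`SkewCutGalerkinFromSections.exists_smooth_eigenvector_Ioo_of_sections'` on `ι = CrayaIdx` (with
`ℓ_i = −ν|k_i|²`, `t_ij (x₀ − ℓ_j) = A_ij`, `w_i^{2s} = (1 + ν|k_i|²)^s`) meets the synthesis door
`AbcLinearisedLattice.isLinNSEigenvalue_abcFlow_of_crossForm`. MODEL statement; not NS. -/
theorem isLinNSEigenvalue_abcFlow_of_craya_eigen (A B C : ℝ) {ν : ℝ} (hν : 0 < ν) {μ : ℂ}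
    {v : CrayaIdx → ℂ} (hv : v ≠ 0)
    (hreg : ∀ s : ℕ, Summable fun i : CrayaIdx => (1 + ν * freqNormSq i.1.1) ^ s * ‖v i‖ ^ 2)
    (nbr : CrayaIdx → Finset CrayaIdx) (hnbr : ∀ i j, j ∉ nbr i → abcCrayaMatrix A B C i j = 0)
    (heig : ∀ i : CrayaIdx, (-(((ν * freqNormSq i.1.1 : ℝ)) : ℂ)) * v i +
        ∑ j ∈ nbr i, abcCrayaMatrix A B C i j * v j = μ * v i) :
    Torus.IsLinNSEigenvalue (ν / (2 * Real.pi)) (Torus.abcFlow A B C) (2 * Real.pi * μ) := by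
  have hcne : crayaSynth v ≠ 0 := fun h => hv ((crayaSynth_eq_zero_iff v).mp h)
  refine AbcLinearisedLattice.isLinNSEigenvalue_abcFlow_of_crossForm A B C ν (rapidDecay_crayaSynth v hν hreg)
    (kdot_crayaSynth v) (crayaSynth_zero_freq v) hcne fun k => ?_
  by_cases hk : k = 0
  · subst hk
    rw [crayaSynth_zero_freq, Torus.lerayCoeff_zero, smul_zero, smul_zero, zero_add]
  rw [lerayCoeff_eq_sum_inner_crayaVec, crayaSynth_of_ne_zero v hk, Finset.smul_sum, Finset.smul_sum,
    ← Finset.sum_add_distrib]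
  refine Finset.sum_congr rfl fun a _ => ?_
  have h := heig (⟨k, hk⟩, a)
  rw [sum_abcCrayaMatrix_mul_eq_of_band A B C v nbr hnbr, sum_abcCrayaMatrix_mul_eq_inner] at h
  -- `h : ℓ v + ⟪e_a, X⟫ = μ v` at the index `(k, a)`
  rw [smul_smul, ← add_smul, smul_smul, ← h]

/-- The same with the canonical band `crayaNbr`. -/
theorem isLinNSEigenvalue_abcFlow_of_craya_eigen' (A B C : ℝ) {ν : ℝ} (hν : 0 < ν) {μ : ℂ}
    {v : CrayaIdx → ℂ} (hv : v ≠ 0)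
    (hreg : ∀ s : ℕ, Summable fun i : CrayaIdx => (1 + ν * freqNormSq i.1.1) ^ s * ‖v i‖ ^ 2)
    (heig : ∀ i : CrayaIdx, (-(((ν * freqNormSq i.1.1 : ℝ)) : ℂ)) * v i +
        ∑ j ∈ crayaNbr i, abcCrayaMatrix A B C i j * v j = μ * v i) :
    Torus.IsLinNSEigenvalue (ν / (2 * Real.pi)) (Torus.abcFlow A B C) (2 * Real.pi * μ) :=
  isLinNSEigenvalue_abcFlow_of_craya_eigen A B C hν hv hreg crayaNbr
    (fun _ _ hj => abcCrayaMatrix_eq_zero_of_not_mem A B C hj) heig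

/-! ### §6 First-order growth of the entries (the constant `K` of ASSEMBLY obligation (A2)) -/

/-- The Beltrami relation of the ABC coefficients in cross-product form: `i q × â(q) = â(q)` on the
shell (`Torus.abcCoeff_eigen`). -/
theorem smul_cross_abcCoeff (A B C : ℝ) (y : Fin 3 × Bool) :
    Complex.I • ((fun j : Fin 3 => ((Torus.abcDir y j : ℤ) : ℂ)) ⨯₃
        WithLp.ofLp (Torus.abcCoeff A B C (Torus.abcDir y))) =
      WithLp.ofLp (Torus.abcCoeff A B C (Torus.abcDir y)) := by
  funext i
  have h := Torus.abcCoeff_eigen A B C y i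
  fin_cases i <;> simpa [cross_apply, Fin.isValue] using h

/-- **Factored form of the entries on the band.** If `k_i − k_j = q_y` then
`A_{ij} = −i (k_j · â(q_y)) ⟪e_i, e_j⟫ − i (q_y · e_j) ⟪e_i, â(q_y)⟫` (transport + stretch; the gradient
part `i (â·e_j) k_i` of `AbcLinearisedLattice.cross_form_pointwise` is killed by `⟪e_i, k_i⟫ = 0`). -/
theorem abcCrayaMatrix_eq_of_sub_eq (A B C : ℝ) {i j : CrayaIdx} {y : Fin 3 × Bool}
    (hy : i.1.1 - j.1.1 = Torus.abcDir y) :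
    abcCrayaMatrix A B C i j =
      -(Complex.I * (∑ m : Fin 3, ((j.1.1 m : ℤ) : ℂ) * Torus.abcCoeff A B C (Torus.abcDir y) m) *
          ⟪crayaVec i.2 i.1.1, crayaVec j.2 j.1.1⟫_ℂ) -
        Complex.I * (∑ m : Fin 3, ((Torus.abcDir y m : ℤ) : ℂ) * crayaVec j.2 j.1.1 m) *
          ⟪crayaVec i.2 i.1.1, Torus.abcCoeff A B C (Torus.abcDir y)⟫_ℂ := by
  have hmem : i.1.1 - j.1.1 ∈ Torus.abcFreq := by rw [hy]; exact Torus.mem_abcFreq.mpr ⟨y, rfl⟩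
  rw [abcCrayaMatrix, if_pos hmem, hy,
    AbcLinearisedLattice.cross_form_pointwise _ _ _ _ (smul_cross_abcCoeff A B C y)]
  set a := Torus.abcCoeff A B C (Torus.abcDir y) with ha
  set e := crayaVec j.2 j.1.1 with he
  -- `k_j + q_y = k_i`
  have hk : ((fun m : Fin 3 => ((j.1.1 m : ℤ) : ℂ)) + fun m : Fin 3 => ((Torus.abcDir y m : ℤ) : ℂ)) =
      WithLp.ofLp (Torus.freqVec i.1.1) := by
    funext m
    have h1 : i.1.1 m - j.1.1 m = Torus.abcDir y m := by
      have := congr_fun hy m; simpa only [Pi.sub_apply] using this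
    have h2 : (i.1.1 m : ℤ) = j.1.1 m + Torus.abcDir y m := by linarith
    simp only [Pi.add_apply, WithLp.ofLp_toLp, Torus.freqVec, h2]
    push_cast
    ring
  rw [hk]
  have e1 : WithLp.toLp 2 (Complex.I • ((WithLp.ofLp a ⬝ᵥ WithLp.ofLp e) • WithLp.ofLp (Torus.freqVec i.1.1)) -
      Complex.I • (((fun m : Fin 3 => ((j.1.1 m : ℤ) : ℂ)) ⬝ᵥ WithLp.ofLp a) • WithLp.ofLp e) -
      Complex.I • (((fun m : Fin 3 => ((Torus.abcDir y m : ℤ) : ℂ)) ⬝ᵥ WithLp.ofLp e) • WithLp.ofLp a)) =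
      (Complex.I * (WithLp.ofLp a ⬝ᵥ WithLp.ofLp e)) • Torus.freqVec i.1.1 -
        (Complex.I * ∑ m : Fin 3, ((j.1.1 m : ℤ) : ℂ) * a m) • e -
        (Complex.I * ∑ m : Fin 3, ((Torus.abcDir y m : ℤ) : ℂ) * e m) • a := by
    ext p
    simp only [Pi.sub_apply, Pi.smul_apply, smul_eq_mul, dotProduct, PiLp.sub_apply, PiLp.smul_apply]
    ring
  rw [e1, inner_sub_right, inner_sub_right, inner_smul_right, inner_smul_right, inner_smul_right,
    inner_crayaVec_freqVec, mul_zero, zero_sub]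

/-- The ABC amplitudes are bounded by `|A| + |B| + |C|`. -/
theorem abs_abcAmp_le (A B C : ℝ) (m : Fin 3) : |Torus.abcAmp A B C m| ≤ |A| + |B| + |C| := by
  have hA := abs_nonneg A; have hB := abs_nonneg B; have hC := abs_nonneg C
  fin_cases m <;> simp [Torus.abcAmp] <;> linarith

/-- `‖â(q_y)‖ ≤ |A| + |B| + |C|` on the shell (`‖â(±e_m)‖² = a_m²/2`). -/
theorem norm_abcCoeff_abcDir_le (A B C : ℝ) (y : Fin 3 × Bool) :
    ‖Torus.abcCoeff A B C (Torus.abcDir y)‖ ≤ |A| + |B| + |C| := by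
  have hsq := AbcLinearisedLattice.norm_sq_abcCoeff_abcDir A B C y
  have hamp := abs_abcAmp_le A B C y.1
  have h0 : 0 ≤ |A| + |B| + |C| := by positivity
  have h1 : ‖Torus.abcCoeff A B C (Torus.abcDir y)‖ ^ 2 ≤ (|A| + |B| + |C|) ^ 2 := by
    rw [hsq]
    have h2 : (Torus.abcAmp A B C y.1) ^ 2 = |Torus.abcAmp A B C y.1| ^ 2 := (sq_abs _).symm
    rw [h2]
    have h3 : |Torus.abcAmp A B C y.1| ^ 2 ≤ (|A| + |B| + |C|) ^ 2 :=
      pow_le_pow_left₀ (abs_nonneg _) hamp 2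
    nlinarith [sq_nonneg (|Torus.abcAmp A B C y.1|)]
  exact (pow_le_pow_iff_left₀ (norm_nonneg _) h0 two_ne_zero).mp h1

/-- `⟨q_y⟩ = √2 ≤ 2` for the shell frequencies. -/
theorem sobolevWeight_abcDir_le (y : Fin 3 × Bool) : sobolevWeight 1 (Torus.abcDir y) ≤ 2 := by
  rw [sobolevWeight, Torus.freqNormSq_abcDir]
  have : ((1 : ℝ) + 1) ^ ((1 : ℝ) / 2) = Real.sqrt 2 := by rw [Real.sqrt_eq_rpow]; norm_num
  rw [this]
  have h2 : Real.sqrt 2 ≤ Real.sqrt 4 := Real.sqrt_le_sqrt (by norm_num)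
  have h4 : Real.sqrt 4 = 2 := by
    rw [show (4 : ℝ) = 2 ^ 2 by norm_num, Real.sqrt_sq (by norm_num : (0 : ℝ) ≤ 2)]
  linarith

/-- **First-order growth of the certifier's matrix** (the constant `K` of ASSEMBLY obligation (A2)):
`‖A_{ij}‖ ≤ 9 (|A| + |B| + |C|) ⟨k_j⟩`, `⟨k⟩ = (1 + |k|²)^{1/2}` (`|m·v| ≤ 3⟨m⟩‖v‖`, `‖e‖ = 1`,
`⟨q_y⟩ ≤ 2 ≤ 2⟨k_j⟩`; off the band the entry is `0`). -/
theorem norm_abcCrayaMatrix_le (A B C : ℝ) (i j : CrayaIdx) :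
    ‖abcCrayaMatrix A B C i j‖ ≤ 9 * (|A| + |B| + |C|) * sobolevWeight 1 j.1.1 := by
  have hS : 0 ≤ |A| + |B| + |C| := by positivity
  have hw1 : 1 ≤ sobolevWeight 1 j.1.1 := one_le_sobolevWeight zero_le_one _
  by_cases hmem : i.1.1 - j.1.1 ∈ Torus.abcFreq
  · obtain ⟨y, hy⟩ := Torus.mem_abcFreq.mp hmem
    rw [abcCrayaMatrix_eq_of_sub_eq A B C hy.symm]
    set a := Torus.abcCoeff A B C (Torus.abcDir y) with ha
    set ei := crayaVec i.2 i.1.1 with hei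
    set ej := crayaVec j.2 j.1.1 with hej
    have hna : ‖a‖ ≤ |A| + |B| + |C| := norm_abcCoeff_abcDir_le A B C y
    have hnei : ‖ei‖ = 1 := norm_crayaVec i.1.2 _
    have hnej : ‖ej‖ = 1 := norm_crayaVec j.1.2 _
    have h1 : ‖-(Complex.I * (∑ m : Fin 3, ((j.1.1 m : ℤ) : ℂ) * a m) * ⟪ei, ej⟫_ℂ)‖ ≤
        3 * sobolevWeight 1 j.1.1 * ‖a‖ := by
      rw [norm_neg, norm_mul, norm_mul, Complex.norm_I, one_mul]
      have hin : ‖⟪ei, ej⟫_ℂ‖ ≤ 1 := by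
        calc ‖⟪ei, ej⟫_ℂ‖ ≤ ‖ei‖ * ‖ej‖ := norm_inner_le_norm ei ej
          _ = 1 := by rw [hnei, hnej, mul_one]
      have h0 : 0 ≤ 3 * sobolevWeight 1 j.1.1 * ‖a‖ :=
        mul_nonneg (mul_nonneg (by norm_num) (sobolevWeight_pos 1 _).le) (norm_nonneg _)
      calc ‖∑ m : Fin 3, ((j.1.1 m : ℤ) : ℂ) * a m‖ * ‖⟪ei, ej⟫_ℂ‖
          ≤ (3 * sobolevWeight 1 j.1.1 * ‖a‖) * 1 :=
            mul_le_mul (norm_kdot_le j.1.1 a) hin (norm_nonneg _) h0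
        _ = 3 * sobolevWeight 1 j.1.1 * ‖a‖ := mul_one _
    have h2 : ‖Complex.I * (∑ m : Fin 3, ((Torus.abcDir y m : ℤ) : ℂ) * ej m) * ⟪ei, a⟫_ℂ‖ ≤
        6 * sobolevWeight 1 j.1.1 * ‖a‖ := by
      rw [norm_mul, norm_mul, Complex.norm_I, one_mul]
      have hin : ‖⟪ei, a⟫_ℂ‖ ≤ ‖a‖ := by
        calc ‖⟪ei, a⟫_ℂ‖ ≤ ‖ei‖ * ‖a‖ := norm_inner_le_norm ei a
          _ = ‖a‖ := by rw [hnei, one_mul]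
      have hq : ‖∑ m : Fin 3, ((Torus.abcDir y m : ℤ) : ℂ) * ej m‖ ≤ 6 * sobolevWeight 1 j.1.1 := by
        calc ‖∑ m : Fin 3, ((Torus.abcDir y m : ℤ) : ℂ) * ej m‖
            ≤ 3 * sobolevWeight 1 (Torus.abcDir y) * ‖ej‖ := norm_kdot_le _ ej
          _ ≤ 3 * 2 * 1 := by
              rw [hnej]
              gcongr
              exact sobolevWeight_abcDir_le y
          _ ≤ 6 * sobolevWeight 1 j.1.1 := by linarith
      have h0 : 0 ≤ 6 * sobolevWeight 1 j.1.1 := mul_nonneg (by norm_num) (sobolevWeight_pos 1 _).le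
      exact mul_le_mul hq hin (norm_nonneg _) h0
    calc ‖-(Complex.I * (∑ m : Fin 3, ((j.1.1 m : ℤ) : ℂ) * a m) * ⟪ei, ej⟫_ℂ) -
          Complex.I * (∑ m : Fin 3, ((Torus.abcDir y m : ℤ) : ℂ) * ej m) * ⟪ei, a⟫_ℂ‖
        ≤ 3 * sobolevWeight 1 j.1.1 * ‖a‖ + 6 * sobolevWeight 1 j.1.1 * ‖a‖ :=
          (norm_sub_le _ _).trans (add_le_add h1 h2)
      _ = 9 * ‖a‖ * sobolevWeight 1 j.1.1 := by ring
      _ ≤ 9 * (|A| + |B| + |C|) * sobolevWeight 1 j.1.1 := by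
          gcongr
  · rw [abcCrayaMatrix, if_neg hmem, norm_zero]
    positivity

end Summit.NavierStokesRegularity.FluidComputer.AbcCrayaMatrix

end
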